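import Summits.Ventures.PackingBounds.Configurations.GramIsometry

/-!
# Clique frames: configurations rebuilt from `n` unit vectors with one common pairwise inner product

Framing: lottery ticket; floor = certified bounds/negative ranges. Venture `PackingBounds` (cell
`pub-packcert`, seat `pub-packcert-energy`) — uniqueness infrastructure for the sharp configurations
`(5, 16)`, `(6, 27)`, `(7, 56)` (Cohn–Kumar Table 1; the `E`-series codes with cosine `θ = 1/(10-n)`).

A *`θ`-frame* is a family `a : ι → E` of unit vectors with `⟪a i, a j⟫ = θ` for `i ≠ j`, i.e. Gram matrix
`(1-θ) I + θ J`. For `0 ≤ θ < 1` such a family is linearly independent (`linearIndependent`); when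
`|ι| = dim E` every vector is a combination `z = Σ dᵢ aᵢ` (`exists_repr`) whose coefficients and norm are read off
from the inner products `⟪z, a j⟫ = (1-θ) d j + θ Σ d` (`inner_repr`, `norm_sq_repr`). The vectors
`fam a T c = Σ_{i ∈ T} aᵢ - c Σᵢ aᵢ` have inner products depending only on `|T ∩ T'|, |T|, |T'|, c, c', θ, |ι|`
(`inner_fam_fam`), so two configurations that are images of the SAME index data over two `θ`-frames are
isometric (`isometric_of_frames`, via `Config.exists_linearIsometryEquiv_of_inner_eq`).

## References
* H. Cohn, A. Kumar, J. Amer. Math. Soc. 20 (2007) 99–148, Table 1 and Appendix A. [`CohnKumar2006`]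
-/

noncomputable section

namespace Summit.Ventures.PackingBounds.Config.CliqueFrame

open Finset Module

variable {E : Type*} [NormedAddCommGroup E] [InnerProductSpace ℝ E]
variable {ι : Type*} [Fintype ι] [DecidableEq ι]
variable {a : ι → E} {θ : ℝ}

/-! ### Inner products of sums over a frame -/

omit [Fintype ι] in
/-- `⟪Σ_{i∈S} aᵢ, Σ_{j∈T} aⱼ⟫ = (1-θ)|S ∩ T| + θ |S| |T|` for a `θ`-frame. -/
theorem inner_sum_sum (hG : ∀ i j, inner ℝ (a i) (a j) = if i = j then 1 else θ) (S T : Finset ι) :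
    inner ℝ (∑ i ∈ S, a i) (∑ j ∈ T, a j) =
      (1 - θ) * ((S ∩ T).card : ℝ) + θ * (S.card : ℝ) * (T.card : ℝ) := by
  rw [sum_inner]
  simp_rw [inner_sum, hG]
  have h : ∀ i ∈ S, ∑ j ∈ T, (if i = j then (1 : ℝ) else θ) =
      θ * (T.card : ℝ) + (if i ∈ T then (1 - θ) else 0) := by
    intro i _
    have h' : ∀ j ∈ T, (if i = j then (1 : ℝ) else θ) = θ + (if i = j then (1 - θ) else 0) := by
      intro j _; split_ifs <;> ring
    rw [sum_congr rfl h', sum_add_distrib, sum_const, nsmul_eq_mul, sum_ite_eq]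
    ring
  rw [sum_congr rfl h, sum_add_distrib, sum_const, nsmul_eq_mul, ← sum_filter, filter_mem_eq_inter,
    sum_const, nsmul_eq_mul]
  ring

/-- `⟪Σᵢ cᵢ aᵢ, Σⱼ dⱼ aⱼ⟫ = (1-θ) Σ cᵢ dᵢ + θ (Σ c)(Σ d)` for a `θ`-frame. -/
theorem inner_combo_combo (hG : ∀ i j, inner ℝ (a i) (a j) = if i = j then 1 else θ) (c d : ι → ℝ) :
    inner ℝ (∑ i, c i • a i) (∑ j, d j • a j) =
      (1 - θ) * ∑ i, c i * d i + θ * (∑ i, c i) * (∑ j, d j) := by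
  rw [sum_inner]
  simp_rw [inner_sum, real_inner_smul_left, real_inner_smul_right, hG]
  have h : ∀ i ∈ (univ : Finset ι), ∑ j, c i * (d j * (if i = j then (1 : ℝ) else θ)) =
      θ * (c i * ∑ j, d j) + (1 - θ) * (c i * d i) := by
    intro i _
    have h' : ∀ j ∈ (univ : Finset ι), c i * (d j * (if i = j then (1 : ℝ) else θ)) =
        θ * (c i * d j) + (if i = j then (1 - θ) * (c i * d j) else 0) := by
      intro j _; split_ifs <;> ring
    rw [sum_congr rfl h', sum_add_distrib, sum_ite_eq, if_pos (mem_univ i), ← mul_sum, ← mul_sum]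
  rw [sum_congr rfl h, sum_add_distrib, ← mul_sum, ← mul_sum, ← sum_mul]
  ring

/-- `⟪Σᵢ dᵢ aᵢ, aⱼ⟫ = (1-θ) dⱼ + θ Σ d`. -/
theorem inner_repr (hG : ∀ i j, inner ℝ (a i) (a j) = if i = j then 1 else θ) (d : ι → ℝ) (j : ι) :
    inner ℝ (∑ i, d i • a i) (a j) = (1 - θ) * d j + θ * ∑ i, d i := by
  rw [sum_inner]
  simp_rw [real_inner_smul_left, hG]
  have h : ∀ i ∈ (univ : Finset ι), d i * (if i = j then (1 : ℝ) else θ) =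
      θ * d i + (if i = j then (1 - θ) * d i else 0) := by
    intro i _; split_ifs <;> ring
  rw [sum_congr rfl h, sum_add_distrib, ← mul_sum, sum_ite_eq', if_pos (mem_univ j)]
  ring

/-- `‖Σᵢ dᵢ aᵢ‖² = (1-θ) Σ dᵢ² + θ (Σ d)²`. -/
theorem norm_sq_repr (hG : ∀ i j, inner ℝ (a i) (a j) = if i = j then 1 else θ) (d : ι → ℝ) :
    ‖∑ i, d i • a i‖ ^ 2 = (1 - θ) * ∑ i, d i ^ 2 + θ * (∑ i, d i) ^ 2 := by
  rw [← real_inner_self_eq_norm_sq, inner_combo_combo hG]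
  simp only [sq]
  ring

/-! ### A frame is a basis -/

/-- A `θ`-frame with `0 ≤ θ < 1` is linearly independent. -/
theorem linearIndependent (hG : ∀ i j, inner ℝ (a i) (a j) = if i = j then 1 else θ)
    (h0 : 0 ≤ θ) (h1 : θ < 1) : LinearIndependent ℝ a := by
  rw [Fintype.linearIndependent_iff]
  intro g hg i
  have h := norm_sq_repr hG g
  rw [hg, norm_zero] at h
  have hS : 0 ≤ ∑ j, g j ^ 2 := sum_nonneg fun j _ => sq_nonneg (g j)
  have hT : 0 ≤ (∑ j, g j) ^ 2 := sq_nonneg _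
  have hS0 : ∑ j, g j ^ 2 = 0 := by nlinarith
  exact pow_eq_zero_iff two_ne_zero |>.mp ((sum_eq_zero_iff_of_nonneg fun j _ => sq_nonneg (g j)).mp hS0 i (mem_univ i))

/-- When `|ι| = dim E`, every vector is a combination of the frame. -/
theorem exists_repr [FiniteDimensional ℝ E] (hG : ∀ i j, inner ℝ (a i) (a j) = if i = j then 1 else θ)
    (h0 : 0 ≤ θ) (h1 : θ < 1) (hcard : Fintype.card ι = finrank ℝ E) (z : E) :
    ∃ d : ι → ℝ, z = ∑ i, d i • a i := by
  have hspan := (linearIndependent hG h0 h1).span_eq_top_of_card_eq_finrank' hcard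
  have hz : z ∈ Submodule.span ℝ (Set.range a) := by rw [hspan]; exact Submodule.mem_top
  obtain ⟨c, hc⟩ := (Submodule.mem_span_range_iff_exists_fun ℝ).mp hz
  exact ⟨c, hc.symm⟩

/-! ### Two-valued profiles -/

omit [DecidableEq ι] in
/-- A sum of a function of a two-valued profile. -/
theorem sum_comp_two_values (f : ι → ℝ) {p q : ℝ} (h : ∀ i, f i = p ∨ f i = q)
    (φ : ℝ → ℝ) [DecidablePred fun i => f i = q] :
    ∑ i, φ (f i) = ((univ.filter fun i => f i = q).card : ℝ) * φ q +
      ((Fintype.card ι : ℝ) - ((univ.filter fun i => f i = q).card : ℝ)) * φ p := by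
  rw [← sum_filter_add_sum_filter_not univ (fun i => f i = q)]
  have hq : ∑ i ∈ univ.filter (fun i => f i = q), φ (f i) = ((univ.filter fun i => f i = q).card : ℝ) * φ q := by
    rw [sum_congr rfl (fun i hi => by rw [(mem_filter.mp hi).2]), sum_const, nsmul_eq_mul]
  have hp : ∑ i ∈ univ.filter (fun i => ¬ f i = q), φ (f i) =
      ((univ.filter fun i => ¬ f i = q).card : ℝ) * φ p := by
    rw [sum_congr rfl (fun i hi => by
      rw [(h i).resolve_right (mem_filter.mp hi).2]), sum_const, nsmul_eq_mul]
  have hc : ((univ.filter fun i => ¬ f i = q).card : ℝ) =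
      (Fintype.card ι : ℝ) - ((univ.filter fun i => f i = q).card : ℝ) := by
    have := Finset.card_filter_add_card_filter_not (s := (univ : Finset ι)) (fun i => f i = q)
    rw [card_univ] at this
    have h' : ((univ.filter fun i => f i = q).card : ℝ) + ((univ.filter fun i => ¬ f i = q).card : ℝ) =
        (Fintype.card ι : ℝ) := by exact_mod_cast this
    linarith
  rw [hq, hp, hc]

/-! ### The family attached to a frame and its Gram matrix -/

/-- `fam a T c = Σ_{i ∈ T} aᵢ - c • Σᵢ aᵢ`. -/
def fam (a : ι → E) (T : Finset ι) (c : ℝ) : E := ∑ i ∈ T, a i - c • ∑ i, a i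

omit [DecidableEq ι] in
/-- `fam a {k} 0 = a k`. -/
theorem fam_singleton_zero (a : ι → E) (k : ι) : fam a {k} 0 = a k := by
  simp [fam]

/-- **The Gram matrix of the family is a function of the index data only.** -/
theorem inner_fam_fam (hG : ∀ i j, inner ℝ (a i) (a j) = if i = j then 1 else θ) (S T : Finset ι) (c d : ℝ) :
    inner ℝ (fam a S c) (fam a T d) =
      ((1 - θ) * ((S ∩ T).card : ℝ) + θ * (S.card : ℝ) * (T.card : ℝ))
        - d * ((1 - θ) * (S.card : ℝ) + θ * (S.card : ℝ) * (Fintype.card ι : ℝ))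
        - c * ((1 - θ) * (T.card : ℝ) + θ * (Fintype.card ι : ℝ) * (T.card : ℝ))
        + c * d * ((1 - θ) * (Fintype.card ι : ℝ) + θ * (Fintype.card ι : ℝ) * (Fintype.card ι : ℝ)) := by
  simp only [fam, inner_sub_left, inner_sub_right, real_inner_smul_left, real_inner_smul_right,
    inner_sum_sum hG, inter_univ, univ_inter, card_univ]
  ring

/-- Gram matrices of the families over two `θ`-frames agree. -/
theorem inner_fam_fam_eq {a' : ι → E} (hG : ∀ i j, inner ℝ (a i) (a j) = if i = j then 1 else θ)
    (hG' : ∀ i j, inner ℝ (a' i) (a' j) = if i = j then 1 else θ) (S T : Finset ι) (c d : ℝ) :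
    inner ℝ (fam a S c) (fam a T d) = inner ℝ (fam a' S c) (fam a' T d) := by
  rw [inner_fam_fam hG, inner_fam_fam hG']

/-- **Isometry of frames.** For index data `set, coef` on a finite type `κ`, the two families over two
`θ`-frames differ by a linear isometry of `E`. -/
theorem exists_isometry_of_frames [FiniteDimensional ℝ E] {κ : Type*} [Fintype κ] (set : κ → Finset ι)
    (coef : κ → ℝ) {a' : ι → E} (hG : ∀ i j, inner ℝ (a i) (a j) = if i = j then 1 else θ)
    (hG' : ∀ i j, inner ℝ (a' i) (a' j) = if i = j then 1 else θ) :
    ∃ Ψ : E ≃ₗᵢ[ℝ] E, ∀ x, Ψ (fam a (set x) (coef x)) = fam a' (set x) (coef x) :=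
  exists_linearIsometryEquiv_of_inner_eq _ _ fun _ _ => inner_fam_fam_eq hG hG' _ _ _ _

/-- **Configurations that are images of the same index data over two `θ`-frames are isometric.** -/
theorem isometric_of_frames [FiniteDimensional ℝ E] [DecidableEq E] {κ : Type*} [Fintype κ]
    (set : κ → Finset ι) (coef : κ → ℝ) {a' : ι → E}
    (hG : ∀ i j, inner ℝ (a i) (a j) = if i = j then 1 else θ)
    (hG' : ∀ i j, inner ℝ (a' i) (a' j) = if i = j then 1 else θ) {C C' : Finset E}
    (hC : C = univ.image fun x => fam a (set x) (coef x))
    (hC' : C' = univ.image fun x => fam a' (set x) (coef x)) :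
    ∃ Ψ : E ≃ₗᵢ[ℝ] E, C' = C.image Ψ := by
  obtain ⟨Ψ, hΨ⟩ := exists_isometry_of_frames set coef hG hG'
  refine ⟨Ψ, ?_⟩
  rw [hC', hC, Finset.image_image]
  exact Finset.image_congr fun x _ => (hΨ x).symm

omit [NormedAddCommGroup E] [InnerProductSpace ℝ E] in
/-- A finite set covered by the image of a map from a type of at most its size IS that image. -/
theorem eq_image_of_forall_exists [DecidableEq E] {κ : Type*} [Fintype κ] (C : Finset E) (g : κ → E)
    (hsub : ∀ z ∈ C, ∃ x, z = g x) (hcard : Fintype.card κ ≤ C.card) : C = univ.image g := by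
  have h1 : C ⊆ univ.image g := fun z hz => by
    obtain ⟨x, rfl⟩ := hsub z hz
    exact mem_image_of_mem _ (mem_univ _)
  exact Finset.eq_of_subset_of_card_le h1 (le_trans card_image_le (by simpa using hcard))

/-! ### Reading a vector off its profile against a full frame -/

/-- **Reconstruction from the profile.** When `|ι| = dim E` and `0 ≤ θ < 1`, every `z` equals
`Σⱼ dⱼ aⱼ` with `dⱼ = (⟪z,aⱼ⟫ - θ Σᵢ⟪z,aᵢ⟫ / (1 + (|ι|-1)θ)) / (1-θ)`. -/
theorem repr_formula [FiniteDimensional ℝ E] (hG : ∀ i j, inner ℝ (a i) (a j) = if i = j then 1 else θ)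
    (h0 : 0 ≤ θ) (h1 : θ < 1) (hcard : Fintype.card ι = finrank ℝ E) (z : E) :
    z = ∑ j, ((inner ℝ z (a j) - θ * (∑ i, inner ℝ z (a i)) / (1 + ((Fintype.card ι : ℝ) - 1) * θ))
      / (1 - θ)) • a j := by
  obtain ⟨d, hd⟩ := exists_repr hG h0 h1 hcard z
  have hb : ∀ j, inner ℝ z (a j) = (1 - θ) * d j + θ * ∑ i, d i := fun j => by rw [hd, inner_repr hG]
  have hB : ∑ i, inner ℝ z (a i) = (1 + ((Fintype.card ι : ℝ) - 1) * θ) * ∑ i, d i := by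
    rw [Finset.sum_congr rfl fun i _ => hb i, sum_add_distrib, ← mul_sum, sum_const, card_univ,
      nsmul_eq_mul]
    ring
  have hκ : (1 + ((Fintype.card ι : ℝ) - 1) * θ) ≠ 0 := by
    have : (0 : ℝ) < 1 + ((Fintype.card ι : ℝ) - 1) * θ := by
      rcases Nat.eq_zero_or_pos (Fintype.card ι) with h | h
      · rw [h]; simp; linarith
      · have : (1 : ℝ) ≤ Fintype.card ι := by exact_mod_cast h
        nlinarith
    exact this.ne'
  have h1' : (1 - θ) ≠ 0 := by linarith
  conv_lhs => rw [hd]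
  refine Finset.sum_congr rfl fun j _ => ?_
  congr 1
  rw [hb j, hB, mul_div_assoc, mul_div_cancel_left₀ _ hκ, add_sub_cancel_right, mul_div_cancel_left₀ _ h1']

/-- **Norm identity.** When `|ι| = dim E` and `0 ≤ θ < 1`, for every `z`:
`(1 + (|ι|-1)θ)(1-θ)‖z‖² = (1 + (|ι|-1)θ) Σⱼ ⟪z,aⱼ⟫² - θ (Σⱼ ⟪z,aⱼ⟫)²`. -/
theorem norm_identity [FiniteDimensional ℝ E] (hG : ∀ i j, inner ℝ (a i) (a j) = if i = j then 1 else θ)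
    (h0 : 0 ≤ θ) (h1 : θ < 1) (hcard : Fintype.card ι = finrank ℝ E) (z : E) :
    (1 + ((Fintype.card ι : ℝ) - 1) * θ) * ((1 - θ) * ‖z‖ ^ 2) =
      (1 + ((Fintype.card ι : ℝ) - 1) * θ) * ∑ j, inner ℝ z (a j) ^ 2 - θ * (∑ j, inner ℝ z (a j)) ^ 2 := by
  obtain ⟨d, hd⟩ := exists_repr hG h0 h1 hcard z
  have hb : ∀ j, inner ℝ z (a j) = (1 - θ) * d j + θ * ∑ i, d i := fun j => by rw [hd, inner_repr hG]
  have hB : ∑ i, inner ℝ z (a i) = (1 + ((Fintype.card ι : ℝ) - 1) * θ) * ∑ i, d i := by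
    rw [Finset.sum_congr rfl fun i _ => hb i, sum_add_distrib, ← mul_sum, sum_const, card_univ,
      nsmul_eq_mul]
    ring
  have hB2 : ∑ j, inner ℝ z (a j) ^ 2 =
      (1 - θ) ^ 2 * ∑ j, d j ^ 2 + 2 * (1 - θ) * θ * (∑ i, d i) * (∑ j, d j) +
        (Fintype.card ι : ℝ) * (θ * ∑ i, d i) ^ 2 := by
    have : ∀ j, inner ℝ z (a j) ^ 2 =
        (1 - θ) ^ 2 * d j ^ 2 + (2 * (1 - θ) * θ * ∑ i, d i) * d j + (θ * ∑ i, d i) ^ 2 := by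
      intro j; rw [hb j]; ring
    rw [Finset.sum_congr rfl fun j _ => this j, sum_add_distrib, sum_add_distrib, ← mul_sum, ← mul_sum,
      sum_const, card_univ, nsmul_eq_mul]
  have hn : ‖z‖ ^ 2 = (1 - θ) * ∑ i, d i ^ 2 + θ * (∑ i, d i) ^ 2 := by rw [hd, norm_sq_repr hG]
  rw [hn, hB2, hB]
  ring

end Summit.Ventures.PackingBounds.Config.CliqueFrame

end
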